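import Literature.LinearAlgebra.TensorNetworks.TensorCrossErrorPropagation
import Literature.LinearAlgebra.TensorNetworks.TensorCrossExactRecovery

/-!
# Quasioptimality of maximum-volume tensor cross interpolation over the balanced dimension tree
# (Savostyanov's Theorem 1)

[Savostyanov2014] D. V. Savostyanov, *Quasioptimality of maximum-volume cross interpolation of
tensors*, Linear Algebra Appl. **458** (2014) 217–244, arXiv:1305.1818 — §3: the interpolation
step (qt), Lemma 1, Lemma 2 (the "splitting lemma") and **Theorem 1**.

The TT interpolation formula built on pivot sets `(I_k, J_k)` at the inner bonds,
`Ã = T₀ P₁⁻¹ T₁ P₂⁻¹ ⋯ P_n⁻¹ T_n` ([Savostyanov2014, eq. (ii)]; here `TCIPivots.tciForm` /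
`tciEval` of `TensorCrossInterpolation`), is analysed in [Savostyanov2014, §3] WITHOUT any
nestedness assumption: if every pivot block `P_k = A(I_k, J_k)` has MAXIMAL VOLUME IN THE WHOLE
bond-`k` UNFOLDING `A^{k} = [A(i_{≤k}; i_{>k})]` and `A` is within `E_C` (entrywise) of a tensor
train of TT-ranks `r_k` (assumption (aa)), then ([Savostyanov2014, Thm. 1, eq. (q1t), Chebyshev
line], for `E_C` sufficiently small)
`|A - Ã| ≤ (2r + κr + 1)^{⌈log₂ d⌉} (r+1)² E_C`,  `r = max r_k`, `κ = max_k r_k |A| |A_k⁻¹|`.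
The proof reads (ii) as `⌈log₂ d⌉` levels of interpolation steps (qt) over the BALANCED DIMENSION
TREE of [Oseledets–Tyrtyshnikov 2009]: the node covering a group of consecutive legs is the cross
of its two halves through `B^{[k]} = P_k⁻¹ = A_k⁻¹`, the leaves (single legs) are exact entries
of `A`, and the splitting Lemma 2 propagates the relative error one level up as
`ε_{m+1} = (2 + κ ε_m) ε_m r + ε₁ ≤ (2r + κr + 1) ε_m`.

This file formalises that argument as a statement about a `d = n+1`-leg tensor
`F : List σ → 𝕜` (legs `0, …, n` here ↔ `1, …, d` in the paper; bond `k` separates the legs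
`< k` from the legs `≥ k`; `P_k = pivMat k` ↔ `A_k`, `χ_k` ↔ `r_k`, `T_k^a = siteMat k a`):

* `TCIPivots.segForm s b e` — the SEGMENT TRAIN `T_b P_{b+1}⁻¹ T_{b+1} ⋯ P_{e-1}⁻¹ T_{e-1}`
  (a `χ_b × χ_e` matrix) = the tree's interpolant of the node covering the legs `b, …, e-1`;
  `tciForm = segForm 0 (n+1)` (`tciForm_eq_segForm`), one-leg segments are site slices
  (`segForm_succ_self`) and every node is the cross of its children,
  `segForm b e = segForm b k · P_k⁻¹ · segForm k e` for `b < k < e` (`segForm_split`) — the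
  interpolation step (qt) read on the formula (ii);
* `TCIPivots.segVal s b e x y = A(I_b x ⊕ (s_b, …, s_{e-1}) ⊕ J_{e+1} y)` — the entry of the
  subtensor `A(𝕀^{≤b}, i_{b+1 : e}, 𝕁^{>e})` interpolated by `(segForm s b e)_{x y}`; the leaves
  are exact (`segVal_succ_eq_segForm`, "zero error at the ground level"); a subtensor entry is an
  entry `(u, v)` of the unfolding kernel at genuine multi-indices (`segVal_eq_unfoldingKernel`,
  which is how Lemma 1 — (qt) restricted to a subtensor — enters);
* LEMMA 2 at one entry: the exact error decomposition `segVal_sub_segForm_eq`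
  (`A(u ⊕ v) - (segForm b e)_{x y} = [A^{k} - crossInterp A^{k}]_{u v} + (c P_k⁻¹ r - c' P_k⁻¹ r')`
  with `c = A(u, J_k)`, `r = A(I_k, v)` and the children's interpolants `c'`, `r'`), the
  splitting identity `c B r - c' B r' = (c B)(r - r') + (c - c')(B r) - (c - c') B (r - r')`
  (`vecMul_dotProduct_sub_vecMul_dotProduct`; the paper's
  `A₁ B A₂ = T₁ B T₂ + A₁ B E₂ + E₁ B A₂ - E₁ B E₂`) and the node estimate
  `norm_segVal_sub_segForm_le_step`: `η + χ_k γ₁ δ₂ + χ_k δ₁ γ₂ + χ_k (χ_k δ₁ β) δ₂` from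
  dominance constants `γ₁, γ₂`, `‖P_k⁻¹‖_C ≤ β`, children errors `δ₁, δ₂` and the one-bond error
  `η` (the matrix form of the same estimate is
  `Literature.LinearAlgebra.Matrix.norm_crossInterp_sub_mul_inv_mul_apply_le` of
  `CrossInterpolationPerturbation`; it is re-proved here at the level of one row and one column
  because the tensor argument only has dominance in the GENUINE rows / columns of `A^{k}`);
* the LEVEL RECURSION `treeErr γ κ r ε₁` (`ε_0 = 0`, `ε_{l+1} = (2γ + κ ε_l) ε_l r + ε₁`), its
  monotonicity (`treeErr_mono`) and closed form `ε_l ≤ (2γr + κr + 1)^{l-1} ε₁` for `1 ≤ l ≤ L`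
  under the explicit smallness `(2γr + κr + 1)^{L-1} ε₁ ≤ 1` (`treeErr_le_pow_mul`; for `γ = 1`
  this is `Literature.LinearAlgebra.Matrix.le_pow_mul_of_levelRecursion`);
* THE TREE INDUCTION `norm_segVal_sub_segForm_le_treeErr`: by strong induction on the number `m`
  of legs of a segment, splitting at `⌊m/2⌋` legs (a balanced tree over `m` leaves has exactly
  `⌈log₂ m⌉` levels above the leaves, `Nat.clog 2 m`), every segment train is within
  `treeErr ⌈log₂ m⌉ · a` of its subtensor.  This gives THEOREM 1 IN RECURSIVE FORM
  `norm_sub_tciEval_le_treeErr` (`‖A(s) - Ã(s)‖ ≤ treeErr ⌈log₂ d⌉ · a`, no smallness needed) and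
  IN CLOSED FORM `norm_sub_tciEval_le_pow_mul` (`≤ (2γr + κr + 1)^{⌈log₂ d⌉-1} ε₁ a`) /
  `norm_sub_tciEval_le_pow_clog_mul` (the printed exponent `⌈log₂ d⌉`), for ANY normed field and
  ANY pivots, from BONDWISE hypotheses at the inner bonds `1 ≤ k ≤ n`: `γ`-dominance of `P_k` in
  the genuine rows and columns of `A^{k}` (`‖A(u, J_k) P_k⁻¹‖_C ≤ γ`, `‖P_k⁻¹ A(I_k, v)‖_C ≤ γ`),
  `‖P_k⁻¹‖_C ≤ β_k` with `χ_k β_k a ≤ κ`, `χ_k ≤ r`, and one-bond cross-interpolation errors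
  `|[A^{k} - A^{k}(·, J_k) P_k⁻¹ A^{k}(I_k, ·)]_{u v}| ≤ ε₁ a` at genuine `(u, v)`;
* THE VERBATIM MAXIMAL-VOLUME STATEMENT over `ℝ` with finitely many values per leg,
  `abs_sub_tciEval_le_of_unfoldings_volume_maximal` (exponent `⌈log₂ d⌉ - 1`) and
  `abs_sub_tciEval_le_of_unfoldings_volume_maximal'` (printed exponent `⌈log₂ d⌉`): with the
  finite unfoldings `TCIPivots.unfolding k : Matrix (List.Vector σ k) (List.Vector σ (n+1-k)) ℝ`
  (of `TensorCrossExactRecovery`),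
  nonsingular pivot blocks of maximal volume among ALL `χ_k × χ_k` submatrices of `A^{k}` give
  dominance with `γ = 1` (`norm_vecMul_inv_pivMat_le_one_of_volume_maximal`,
  `norm_inv_pivMat_mulVec_le_one_of_volume_maximal`, from (dom) =
  `Literature.LinearAlgebra.Matrix.abs_mul_inv_submatrix_le_one_of_volume_maximal`) and one-bond
  errors `≤ (χ_k + 1)² E` when `A^{k}` is within `E` of a matrix of rank `≤ χ_k`
  (`abs_unfoldingKernel_sub_crossInterp_le_of_volume_maximal`, from the matrix maximal-volume
  principle (mv) = `Literature.LinearAlgebra.Matrix.abs_sub_crossInterp_le_of_volume_maximal`);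
  with `χ_k ≤ r`, `χ_k ‖P_k⁻¹‖_C a ≤ κ` and the smallness `(2r + κr + 1)^{⌈log₂ d⌉-1} (r+1)² E ≤ a`
  the conclusion is `|A(s) - Ã(s)| ≤ (2r + κr + 1)^{⌈log₂ d⌉-1} (r+1)² E` at every `s`.

## Deviations from the printed statement (all explicit in the hypotheses)

* RELATIVE VS ABSOLUTE. The paper measures errors relative to `|A| = ‖A‖_C` and puts `|A|` into
  `κ = max_k r_k |A| |A_k⁻¹|`.  A tensor `List σ → 𝕜` need not have a finite or attained sup, so
  we carry an arbitrary SCALE `a ≥ 0` in its place: errors are `treeErr · a`, the one-bond input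
  is `ε₁ a`, and `κ` enters only through `χ_k ‖P_k⁻¹‖_C a ≤ κ`.  With `a = |A|` (when it exists)
  this is the paper's setting verbatim; Remark 1 of the paper (`κ` vs the Chebyshev condition
  number of `A_k`) is not formalised.
* "SUFFICIENTLY SMALL". The closed form uses `ε_m ≤ 1` at every level ("provided by the
  assumption that `E_F` and `E_C` are sufficiently small"); we make it the explicit hypothesis
  `(2γr + κr + 1)^{L-1} ε₁ ≤ 1`, `L = ⌈log₂ d⌉` — in the verbatim corollary
  `(2r + κr + 1)^{⌈log₂ d⌉-1} (r+1)² E ≤ a`, weaker than the paper's reading "the estimate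
  provides `|A - Ã|/|A| < 1`".  The recursive bound holds unconditionally.
* EXPONENT. A balanced tree over `d` leaves has `⌈log₂ d⌉` levels above the leaves, whence
  `(2r + κr + 1)^{⌈log₂ d⌉-1}`; the paper's count `2^l ≤ 2d`, `l ≤ log₂ d + 1` gives the printed,
  one factor weaker `(2r + κr + 1)^{⌈log₂ d⌉}` (the primed statements).
* DOMINANCE CONSTANT. Lemma 2 and the recursion are carried with a general dominance constant `γ`
  (`2γ` in place of `2`); the paper has `γ = 1` from maximal volume.  This is bookkeeping, not a
  new result.
* `E ≥ 0` is assumed explicitly (for `n = 0` there is no inner bond to force it).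

NOT formalised here: the Frobenius-norm lines of (q1), (q1t) and Corollaries 1–2 (they need
singular values / `(r+1) σ_{r+1}` bounds, absent from Mathlib; cf. the module docstring of
`MaximalVolumeErrorBounds`), the existence or computation of maximal-volume pivots, §4 (nested
indices: Theorems 2 and 3 are `TensorCrossErrorPropagation` and `TensorCrossErrorAccumulation`)
and §5.

AI-produced formalisation (H21 engines group, seat eng-quad-2, 2026-08-21); Lean 4 + Mathlib, no
`sorry`, no axioms beyond Mathlib's standard ones, no new facts: every assumption of the paper is
an explicit hypothesis.  Helper lemmas on index windows are `[folklore]`.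
-/

open Matrix Finset

namespace Literature.LinearAlgebra.TensorNetworks

/-! ### Windows of an index sequence (bookkeeping for subtensors) -/

section Config

variable {σ : Type*}

/-- [folklore] -/
private theorem sfx_succ_left' (s : ℕ → σ) (k m : ℕ) :
    sfx s k (m + 1) = s k :: sfx s (k + 1) m := rfl

/-- [folklore] -/
private theorem length_sfx'' (s : ℕ → σ) : ∀ (m k : ℕ), (sfx s k m).length = m
  | 0, _ => rfl
  | m + 1, k => by rw [sfx_succ_left', List.length_cons, length_sfx'' s m (k + 1)]

/-- [folklore] -/
private theorem sfx_append_sfx (s : ℕ → σ) :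
    ∀ (m₁ k m₂ : ℕ), sfx s k m₁ ++ sfx s (k + m₁) m₂ = sfx s k (m₁ + m₂)
  | 0, k, m₂ => by simp
  | m₁ + 1, k, m₂ => by
      rw [sfx_succ_left', List.cons_append, show k + (m₁ + 1) = (k + 1) + m₁ by omega,
        sfx_append_sfx s m₁ (k + 1) m₂, show m₁ + 1 + m₂ = (m₁ + m₂) + 1 by omega,
        sfx_succ_left']

/-- [folklore] -/
private theorem sfx_zero'' (s : ℕ → σ) (k : ℕ) : sfx s k 0 = [] := rfl

/-- [folklore] -/
private theorem pfx_succ'' (s : ℕ → σ) (k : ℕ) : pfx s (k + 1) = pfx s k ++ [s k] := rfl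

/-- [folklore] -/
private theorem sfx_succ_right'' (s : ℕ → σ) (k m : ℕ) :
    sfx s k (m + 1) = sfx s k m ++ [s (k + m)] := by
  rw [← sfx_append_sfx s m k 1]
  rfl

/-- [folklore] -/
private theorem pfx_eq_sfx (s : ℕ → σ) : ∀ k, pfx s k = sfx s 0 k
  | 0 => rfl
  | k + 1 => by rw [pfx_succ'', pfx_eq_sfx s k, sfx_succ_right'', Nat.zero_add]

end Config

/-! ### The level recursion of the balanced dimension tree -/

section LevelRecursion

/-- THE LEVEL ERRORS OF THE DIMENSION TREE: `treeErr γ κ r ε₁ 0 = 0` (leaves are exact entries)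
and `treeErr (l+1) = (2γ + κ · treeErr l) · treeErr l · r + ε₁` — the splitting-lemma recursion
`ε_{m+1} = (2 + κ ε_m) ε_m r + ε₁` of the proof of [Savostyanov2014, Thm. 1], with a general
dominance constant `γ` (`γ = 1` for maximal-volume pivots) in place of the `2 = 2 · 1`.
[cite: Savostyanov2014, §3 Thm. 1 (proof)] -/
def treeErr (γ κ r ε₁ : ℝ) : ℕ → ℝ
  | 0 => 0
  | l + 1 => (2 * γ + κ * treeErr γ κ r ε₁ l) * treeErr γ κ r ε₁ l * r + ε₁

/-- [cite: Savostyanov2014, §3 Thm. 1 (proof: zero error at the ground level)] -/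
@[simp] theorem treeErr_zero (γ κ r ε₁ : ℝ) : treeErr γ κ r ε₁ 0 = 0 := rfl

/-- [cite: Savostyanov2014, §3 Thm. 1 (proof: `ε_{m+1} = (2 + κ ε_m) ε_m r + ε₁`)] -/
theorem treeErr_succ (γ κ r ε₁ : ℝ) (l : ℕ) :
    treeErr γ κ r ε₁ (l + 1) = (2 * γ + κ * treeErr γ κ r ε₁ l) * treeErr γ κ r ε₁ l * r + ε₁ :=
  rfl

/-- [cite: Savostyanov2014, §3 Thm. 1 (proof: the level-1 error is `ε₁`)] -/
@[simp] theorem treeErr_one (γ κ r ε₁ : ℝ) : treeErr γ κ r ε₁ 1 = ε₁ := by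
  simp [treeErr_succ]

/-- [folklore] The splitting-lemma map `x ↦ (2γ + κ x) x r + ε₁` is monotone on `x ≥ 0`. -/
private theorem splitMap_mono {γ κ r ε₁ : ℝ} (hγ : 0 ≤ γ) (hκ : 0 ≤ κ) (hr : 0 ≤ r) {x y : ℝ}
    (hx : 0 ≤ x) (hxy : x ≤ y) :
    (2 * γ + κ * x) * x * r + ε₁ ≤ (2 * γ + κ * y) * y * r + ε₁ := by
  have hy : 0 ≤ y := hx.trans hxy
  have h1 : 2 * γ + κ * x ≤ 2 * γ + κ * y := by nlinarith [mul_le_mul_of_nonneg_left hxy hκ]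
  have h0 : 0 ≤ 2 * γ + κ * x := by positivity
  have h2 : (2 * γ + κ * x) * x ≤ (2 * γ + κ * y) * y :=
    mul_le_mul h1 hxy hx (h0.trans h1)
  linarith [mul_le_mul_of_nonneg_right h2 hr]

/-- [cite: Savostyanov2014, §3 Thm. 1 (proof)] The level errors are nonnegative. -/
theorem treeErr_nonneg {γ κ r ε₁ : ℝ} (hγ : 0 ≤ γ) (hκ : 0 ≤ κ) (hr : 0 ≤ r) (hε₁ : 0 ≤ ε₁) :
    ∀ l, 0 ≤ treeErr γ κ r ε₁ l
  | 0 => le_rfl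
  | l + 1 => by
      have ih := treeErr_nonneg hγ hκ hr hε₁ l
      rw [treeErr_succ]
      positivity

/-- [cite: Savostyanov2014, §3 Thm. 1 (proof)] The level errors do not decrease with the level
(so a node's error bound only depends on an upper bound for the depths of its subtrees). -/
theorem treeErr_mono {γ κ r ε₁ : ℝ} (hγ : 0 ≤ γ) (hκ : 0 ≤ κ) (hr : 0 ≤ r) (hε₁ : 0 ≤ ε₁) :
    Monotone (treeErr γ κ r ε₁) := by
  refine monotone_nat_of_le_succ fun l => ?_
  induction l with
  | zero => simpa using hε₁
  | succ l ih =>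
      rw [treeErr_succ, treeErr_succ γ κ r ε₁ (l + 1)]
      exact splitMap_mono hγ hκ hr (treeErr_nonneg hγ hκ hr hε₁ l) ih

/-- [cite: Savostyanov2014, §3 Thm. 1 (proof, `ε_l = (2r + κr + 1)^{l-1} ε₁`)]
CLOSED FORM OF THE LEVEL RECURSION with a general dominance constant: if
`(2γr + κr + 1)^{L-1} ε₁ ≤ 1` ("`ε₁` sufficiently small" for `L` levels, which keeps every
`treeErr l ≤ 1` on the way up), then `treeErr l ≤ (2γr + κr + 1)^{l-1} ε₁` for `1 ≤ l ≤ L`.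
For `γ = 1` this is `Literature.LinearAlgebra.Matrix.le_pow_mul_of_levelRecursion` applied to
the sequence `treeErr`. -/
theorem treeErr_le_pow_mul {γ κ r ε₁ : ℝ} (hγ : 0 ≤ γ) (hκ : 0 ≤ κ) (hr : 0 ≤ r) (hε₁ : 0 ≤ ε₁)
    {L : ℕ} (hL : (2 * γ * r + κ * r + 1) ^ (L - 1) * ε₁ ≤ 1) :
    ∀ l, 1 ≤ l → l ≤ L → treeErr γ κ r ε₁ l ≤ (2 * γ * r + κ * r + 1) ^ (l - 1) * ε₁ := by
  set G : ℝ := 2 * γ * r + κ * r + 1 with hG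
  have hG₁ : 1 ≤ G := by
    rw [hG]
    nlinarith [mul_nonneg hκ hr, mul_nonneg (mul_nonneg (by norm_num : (0:ℝ) ≤ 2) hγ) hr]
  intro l hl
  induction l, hl using Nat.le_induction with
  | base =>
    intro _
    simp
  | succ l hl ih =>
    intro hlL
    have ihl : treeErr γ κ r ε₁ l ≤ G ^ (l - 1) * ε₁ := ih (Nat.le_of_succ_le hlL)
    have hpow : G ^ (l - 1) * ε₁ ≤ G ^ (L - 1) * ε₁ :=
      mul_le_mul_of_nonneg_right (pow_le_pow_right₀ hG₁ (by omega)) hε₁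
    have hel₁ : treeErr γ κ r ε₁ l ≤ 1 := ihl.trans (hpow.trans hL)
    have hel₀ : 0 ≤ treeErr γ κ r ε₁ l := treeErr_nonneg hγ hκ hr hε₁ l
    rw [treeErr_succ]
    have h2 : (2 * γ + κ * treeErr γ κ r ε₁ l) * treeErr γ κ r ε₁ l * r ≤
        (2 * γ + κ) * treeErr γ κ r ε₁ l * r := by
      refine mul_le_mul_of_nonneg_right ?_ hr
      refine mul_le_mul_of_nonneg_right ?_ hel₀
      linarith [mul_le_mul_of_nonneg_left hel₁ hκ]
    have h3 : ε₁ ≤ G ^ (l - 1) * ε₁ := le_mul_of_one_le_left hε₁ (one_le_pow₀ hG₁)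
    have h4 : (2 * γ + κ) * treeErr γ κ r ε₁ l * r ≤ (2 * γ + κ) * (G ^ (l - 1) * ε₁) * r := by
      refine mul_le_mul_of_nonneg_right ?_ hr
      exact mul_le_mul_of_nonneg_left ihl (by positivity)
    have e1 : G ^ (l + 1 - 1) * ε₁ = (2 * γ + κ) * (G ^ (l - 1) * ε₁) * r + G ^ (l - 1) * ε₁ := by
      have hl1 : l + 1 - 1 = (l - 1) + 1 := by omega
      rw [hl1, pow_succ, hG]
      ring
    rw [e1]
    linarith

/-- [cite: Savostyanov2014, §3 Thm. 1 (proof, balanced tree)] At the top of a tree with `L`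
levels: `treeErr L ≤ (2γr + κr + 1)^{L-1} ε₁` under the same smallness assumption (for `L = 0`,
a single leg, the bound reads `0 ≤ …`). -/
theorem treeErr_le_pow_mul_top {γ κ r ε₁ : ℝ} (hγ : 0 ≤ γ) (hκ : 0 ≤ κ) (hr : 0 ≤ r)
    (hε₁ : 0 ≤ ε₁) {L : ℕ} (hL : (2 * γ * r + κ * r + 1) ^ (L - 1) * ε₁ ≤ 1) :
    treeErr γ κ r ε₁ L ≤ (2 * γ * r + κ * r + 1) ^ (L - 1) * ε₁ := by
  rcases Nat.eq_zero_or_pos L with rfl | hL₁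
  · simpa using hε₁
  · exact treeErr_le_pow_mul hγ hκ hr hε₁ hL L hL₁ le_rfl

end LevelRecursion

/-! ### The splitting identity and its entrywise bound (one interpolation step) -/

section Splitting

variable {K : Type*} [CommRing K] {ι : Type*} [Fintype ι]

/-- [cite: Savostyanov2014, §3 Lemma 2 (proof: `A₁ B A₂ = T₁ B T₂ + A₁ B E₂ + E₁ B A₂ - E₁ B E₂`)]
THE SPLITTING IDENTITY at one entry, for a row `c` of the column factor, a column `r` of the
row factor, their approximants `c'`, `r'` and the middle matrix `B = P⁻¹`:
`c B r - c' B r' = (c B)(r - r') + (c - c')(B r) - (c - c') B (r - r')`. -/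
theorem vecMul_dotProduct_sub_vecMul_dotProduct (B : Matrix ι ι K) (c c' r r' : ι → K) :
    (c ᵥ* B) ⬝ᵥ r - (c' ᵥ* B) ⬝ᵥ r' =
      (c ᵥ* B) ⬝ᵥ (r - r') + (c - c') ⬝ᵥ (B *ᵥ r) - ((c - c') ᵥ* B) ⬝ᵥ (r - r') := by
  rw [Matrix.dotProduct_mulVec, Matrix.sub_vecMul, dotProduct_sub, sub_dotProduct, sub_dotProduct,
    dotProduct_sub, dotProduct_sub]
  ring

variable {𝕜 : Type*} [NormedField 𝕜]

/-- [folklore] `‖v · w‖ ≤ #ι · (A · B)` from entrywise bounds `‖v t‖ ≤ A`, `‖w t‖ ≤ B`. -/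
private theorem norm_dotProduct_le_card_mul {v w : ι → 𝕜} {A B : ℝ} (hv : ∀ t, ‖v t‖ ≤ A)
    (hw : ∀ t, ‖w t‖ ≤ B) : ‖v ⬝ᵥ w‖ ≤ Fintype.card ι * (A * B) := by
  calc ‖v ⬝ᵥ w‖ = ‖∑ t, v t * w t‖ := rfl
    _ ≤ ∑ t, ‖v t * w t‖ := norm_sum_le _ _
    _ ≤ ∑ _t : ι, A * B := Finset.sum_le_sum fun t _ => by
        rw [norm_mul]
        exact mul_le_mul (hv t) (hw t) (norm_nonneg _) ((norm_nonneg _).trans (hv t))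
    _ = Fintype.card ι * (A * B) := by simp

/-- [folklore] `‖(v B) u‖ ≤ #ι · (A · β)` from entrywise bounds `‖v t‖ ≤ A`, `‖B t u‖ ≤ β`. -/
private theorem norm_vecMul_apply_le_card_mul {v : ι → 𝕜} {B : Matrix ι ι 𝕜} {A β : ℝ}
    (hv : ∀ t, ‖v t‖ ≤ A) (hB : ∀ t u, ‖B t u‖ ≤ β) (u : ι) :
    ‖(v ᵥ* B) u‖ ≤ Fintype.card ι * (A * β) :=
  norm_dotProduct_le_card_mul hv fun t => hB t u

/-- [cite: Savostyanov2014, §3 Lemma 2]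
THE SPLITTING LEMMA at one entry, general coefficients: if `‖(c B) t‖ ≤ γ₁` and `‖(B r) t‖ ≤ γ₂`
(dominance of the pivot block in the row of `c` and the column of `r`), `‖B t u‖ ≤ β`,
`‖c - c'‖ ≤ e₁` and `‖r - r'‖ ≤ e₂` entrywise, then
`‖c B r - c' B r'‖ ≤ k γ₁ e₂ + k e₁ γ₂ + k (k e₁ β) e₂` (`k = #ι`), the three terms bounding
`A₁ B E₂`, `E₁ B A₂` and `E₁ B E₂`.  The matrix form of the same estimate is
`Literature.LinearAlgebra.Matrix.norm_crossInterp_sub_mul_inv_mul_apply_le`. -/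
theorem norm_vecMul_dotProduct_sub_le (B : Matrix ι ι 𝕜) (c c' r r' : ι → 𝕜)
    {γ₁ γ₂ β e₁ e₂ : ℝ} (hC : ∀ t, ‖(c ᵥ* B) t‖ ≤ γ₁) (hR : ∀ t, ‖(B *ᵥ r) t‖ ≤ γ₂)
    (hβ : ∀ t u, ‖B t u‖ ≤ β) (h₁ : ∀ t, ‖c t - c' t‖ ≤ e₁) (h₂ : ∀ t, ‖r t - r' t‖ ≤ e₂) :
    ‖(c ᵥ* B) ⬝ᵥ r - (c' ᵥ* B) ⬝ᵥ r'‖ ≤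
      Fintype.card ι * (γ₁ * e₂) + Fintype.card ι * (e₁ * γ₂)
        + Fintype.card ι * (Fintype.card ι * (e₁ * β) * e₂) := by
  have h₁' : ∀ t, ‖(c - c') t‖ ≤ e₁ := fun t => by simpa using h₁ t
  have h₂' : ∀ t, ‖(r - r') t‖ ≤ e₂ := fun t => by simpa using h₂ t
  have T1 : ‖(c ᵥ* B) ⬝ᵥ (r - r')‖ ≤ Fintype.card ι * (γ₁ * e₂) :=
    norm_dotProduct_le_card_mul hC h₂'
  have T2 : ‖(c - c') ⬝ᵥ (B *ᵥ r)‖ ≤ Fintype.card ι * (e₁ * γ₂) :=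
    norm_dotProduct_le_card_mul h₁' hR
  have T3 : ‖((c - c') ᵥ* B) ⬝ᵥ (r - r')‖ ≤
      Fintype.card ι * (Fintype.card ι * (e₁ * β) * e₂) :=
    norm_dotProduct_le_card_mul (fun u => norm_vecMul_apply_le_card_mul h₁' hβ u) h₂'
  rw [vecMul_dotProduct_sub_vecMul_dotProduct]
  exact (norm_sub_le _ _).trans (add_le_add ((norm_add_le _ _).trans (add_le_add T1 T2)) T3)

end Splitting

namespace TCIPivots

variable {σ : Type*} (p : TCIPivots σ)

section CommRing

variable {K : Type*} [CommRing K] (F : List σ → K)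

/-! ### Segment trains `T_b P_{b+1}⁻¹ T_{b+1} ⋯ P_{e-1}⁻¹ T_{e-1}` and the splitting -/

/-- The Kronecker matrix `(x, y) ↦ [x = y]` between the index types of the bonds `ℓ` and `ℓ'`
(the identity matrix when `ℓ = ℓ'`; it lets the segment trains be defined by recursion on the
right end without dependent casts, cf. `bdry`).  [folklore] -/
def kron (ℓ ℓ' : ℕ) : Matrix (Fin (p.χ ℓ)) (Fin (p.χ ℓ')) K :=
  Matrix.of fun x y => if (x : ℕ) = (y : ℕ) then 1 else 0

/-- [folklore] -/
private theorem kron_self (ℓ : ℕ) : (p.kron ℓ ℓ : Matrix (Fin (p.χ ℓ)) (Fin (p.χ ℓ)) K) = 1 := by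
  ext x y
  simp [kron, Matrix.one_apply, Fin.ext_iff]

/-- THE SEGMENT TRAIN of the legs `b, …, e-1` at the configuration `s`:
`segForm s b e = T_b^{s b} P_{b+1}⁻¹ T_{b+1}^{s (b+1)} ⋯ P_{e-1}⁻¹ T_{e-1}^{s (e-1)}`, a
`χ_b × χ_e` matrix (`T_ℓ^a = siteMat ℓ a`, `P_ℓ = pivMat ℓ`); for `e = b + 1` it is the site slice
`T_b^{s b}` itself and for `(b, e) = (0, n+1)` it is the whole TT interpolation formula
(`tciForm_eq_segForm`).  Its entry `(x, y)` is the dimension tree's interpolant of the SUBTENSOR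
`A(I_b x, i_b, …, i_{e-1}, J_{e+1} y)` of [Savostyanov2014, §3] (his `T_□`, `T_◇`; legs here
`0, …, n`, his `1, …, d`).  Values for `e ≤ b` are junk.
[cite: Savostyanov2014, §3 eq. (ii) and proof of Thm. 1] -/
noncomputable def segForm (s : ℕ → σ) (b : ℕ) : (e : ℕ) → Matrix (Fin (p.χ b)) (Fin (p.χ e)) K
  | 0 => p.kron b 0
  | e + 1 =>
      if b = e then p.kron b e * p.siteMat F e (s e)
      else if b < e then segForm s b e * ((p.pivMat F e)⁻¹ * p.siteMat F e (s e))
      else p.kron b (e + 1)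

/-- A one-leg segment is the site slice: `segForm s b (b+1) = T_b^{s b}`.
[cite: Savostyanov2014, §3 (leaves of the dimension tree)] -/
theorem segForm_succ_self (s : ℕ → σ) (b : ℕ) :
    p.segForm F s b (b + 1) = p.siteMat F b (s b) := by
  rw [segForm, if_pos rfl, kron_self]
  exact Matrix.one_mul _

/-- Extending a segment by one leg on the right: for `b < e`,
`segForm s b (e+1) = segForm s b e · P_e⁻¹ T_e^{s e}`.  [cite: Savostyanov2014, §3 eq. (ii)] -/
theorem segForm_succ_of_lt (s : ℕ → σ) {b e : ℕ} (h : b < e) :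
    p.segForm F s b (e + 1) = p.segForm F s b e * ((p.pivMat F e)⁻¹ * p.siteMat F e (s e)) := by
  rw [segForm, if_neg (Nat.ne_of_lt h), if_pos h]

/-- THE SPLITTING of a segment train at an inner bond `k` (`b < k < e`):
`segForm s b e = segForm s b k · P_k⁻¹ · segForm s k e` — the interpolation step (qt) of
[Savostyanov2014, §3] read on the formula (ii): every node of the dimension tree is the cross of
its two children through `B^{[k]} = P_k⁻¹`.  [cite: Savostyanov2014, §3 eq. (qt), (ii)] -/
theorem segForm_split (s : ℕ → σ) {b k : ℕ} (hbk : b < k) :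
    ∀ e, k < e → p.segForm F s b e = p.segForm F s b k * ((p.pivMat F k)⁻¹ * p.segForm F s k e) := by
  intro e hke
  induction e, hke using Nat.le_induction with
  | base => rw [p.segForm_succ_of_lt F s hbk, segForm_succ_self]
  | succ e hke ih =>
      have hke' : k < e := hke
      rw [p.segForm_succ_of_lt F s (hbk.trans hke'), p.segForm_succ_of_lt F s hke', ih]
      simp only [Matrix.mul_assoc]

/-- [cite: Savostyanov2014, §3 eq. (ii)] The left segments times the right partial products
reassemble the TCI form: `segForm s 0 k · rightProd s k = tciForm s` for `1 ≤ k ≤ n+1`. -/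
theorem segForm_zero_mul_rightProd (s : ℕ → σ) :
    ∀ k, 1 ≤ k → k ≤ p.n + 1 → p.segForm F s 0 k * p.rightProd F s k = p.tciForm F s := by
  intro k hk
  induction k, hk using Nat.le_induction with
  | base =>
      intro _
      have h1 : p.segForm F s 0 1 = p.siteMat F 0 (s 0) := p.segForm_succ_self F s 0
      rw [h1]
      rfl
  | succ k hk ih =>
      intro hk1
      rw [p.segForm_succ_of_lt F s (show 0 < k by omega), Matrix.mul_assoc, Matrix.mul_assoc,
        ← Matrix.mul_assoc (p.pivMat F k)⁻¹, ← p.rightProd_of_le F s (show k ≤ p.n by omega)]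
      exact ih (by omega)

/-- THE TT INTERPOLATION FORMULA IS THE ROOT OF THE TREE: `tciForm s = segForm s 0 (n+1)`.
[cite: Savostyanov2014, §3 eq. (ii)] -/
theorem tciForm_eq_segForm (s : ℕ → σ) : p.tciForm F s = p.segForm F s 0 (p.n + 1) := by
  rw [← p.segForm_zero_mul_rightProd F s (p.n + 1) (by omega) le_rfl, p.rightProd_last F s,
    Matrix.mul_one]

/-- `Ã(s) = (segForm s 0 (n+1))_{x₀ y₀}` (the root segment is a `1 × 1` matrix).
[cite: Savostyanov2014, §3 eq. (ii)] -/
theorem tciEval_eq_segForm_apply (s : ℕ → σ) :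
    p.tciEval F s = p.segForm F s 0 (p.n + 1) p.rowZero p.colLast := by
  rw [p.tciEval_eq_tciForm F s p.rowZero p.colLast, tciForm_eq_segForm]

/-! ### Subtensor entries and the exactness of the leaves -/

/-- THE SUBTENSOR ENTRY interpolated by `(segForm s b e)_{x y}`:
`segVal s b e x y = A(I_b x ⊕ (s_b, …, s_{e-1}) ⊕ J_{e+1} y) = F (row b x ⊕ sfx s b (e-b) ⊕ col e y)`
— an entry of Savostyanov's subtensor `A(𝕀^{≤b}, i_{b+1 : e}, 𝕁^{>e})` (1-based legs).  As a
function of `y` at `e = k` it is the row `A(u, J_k)` of the bond-`k` unfolding at the genuine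
multi-index `u = row b x ⊕ sfx s b (k-b)`, and as a function of `x` at `b = k` it is the column
`A(I_k, v)`.  [cite: Savostyanov2014, §3 Lemma 2] -/
def segVal (s : ℕ → σ) (b e : ℕ) (x : Fin (p.χ b)) (y : Fin (p.χ e)) : K :=
  F (p.row b x ++ sfx s b (e - b) ++ p.col e y)

omit [CommRing K] in
/-- [cite: Savostyanov2014, §3 Lemma 2] -/
theorem segVal_apply (s : ℕ → σ) (b e : ℕ) (x : Fin (p.χ b)) (y : Fin (p.χ e)) :
    p.segVal F s b e x y = F (p.row b x ++ sfx s b (e - b) ++ p.col e y) := rfl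

/-- THE LEAVES ARE EXACT: a one-leg segment train reproduces the tensor,
`(T_b^{s b})_{x y} = A(I_b x, s_b, J_{b+2} y)` ("zero error at the ground level").
[cite: Savostyanov2014, §3 Thm. 1 (proof)] -/
theorem segVal_succ_eq_segForm (s : ℕ → σ) (b : ℕ) (x : Fin (p.χ b)) (y : Fin (p.χ (b + 1))) :
    p.segVal F s b (b + 1) x y = p.segForm F s b (b + 1) x y := by
  rw [segForm_succ_self, siteMat_apply, segVal_apply, Nat.add_sub_cancel_left, sfx_succ_left',
    List.append_assoc]
  rfl

omit [CommRing K] in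
/-- The root subtensor entry is the tensor entry: `segVal s 0 (n+1) x₀ y₀ = A(s_0, …, s_n)`.
[cite: Savostyanov2014, §3 Thm. 1] -/
theorem segVal_zero_last (s : ℕ → σ) :
    p.segVal F s 0 (p.n + 1) p.rowZero p.colLast = F (pfx s (p.n + 1)) := by
  have h0 : p.row 0 p.rowZero = [] := List.eq_nil_of_length_eq_zero (p.length_row 0 _)
  have h1 : p.col (p.n + 1) p.colLast = [] :=
    List.eq_nil_of_length_eq_zero (by rw [p.length_col]; omega)
  rw [segVal_apply, h0, h1, List.nil_append, List.append_nil, Nat.sub_zero, pfx_eq_sfx]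

omit [CommRing K] in
/-- Splitting the window of a subtensor entry at an inner bond `k`:
`row b x ⊕ sfx s b (e-b) ⊕ col e y = (row b x ⊕ sfx s b (k-b)) ⊕ (sfx s k (e-k) ⊕ col e y)`, i.e.
the entry `(x; y)` of the subtensor of the legs `b … e-1` is the entry `(u, v)` of the bond-`k`
unfolding with `u = row b x ⊕ sfx s b (k-b)` (length `k`) and `v = sfx s k (e-k) ⊕ col e y`
(length `n+1-k`).  [cite: Savostyanov2014, §3 Lemma 2 (proof)] -/
theorem segVal_eq_unfoldingKernel (s : ℕ → σ) {b k e : ℕ} (hbk : b ≤ k) (hke : k ≤ e)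
    (x : Fin (p.χ b)) (y : Fin (p.χ e)) :
    p.segVal F s b e x y =
      unfoldingKernel F (p.row b x ++ sfx s b (k - b)) (sfx s k (e - k) ++ p.col e y) := by
  rw [segVal_apply, unfoldingKernel_apply, show e - b = (k - b) + (e - k) by omega,
    ← sfx_append_sfx s (k - b) b (e - k), show b + (k - b) = k by omega]
  simp only [List.append_assoc]

omit [CommRing K] in
/-- [folklore] -/
private theorem length_row_append_sfx (s : ℕ → σ) {b k : ℕ} (hbk : b ≤ k) (x : Fin (p.χ b)) :
    (p.row b x ++ sfx s b (k - b)).length = k := by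
  rw [List.length_append, p.length_row, length_sfx'']; omega

omit [CommRing K] in
/-- [folklore] -/
private theorem length_sfx_append_col (s : ℕ → σ) {k e : ℕ} (hke : k ≤ e) (he : e ≤ p.n + 1)
    (y : Fin (p.χ e)) : (sfx s k (e - k) ++ p.col e y).length = p.n + 1 - k := by
  rw [List.length_append, p.length_col, length_sfx'']; omega

omit [CommRing K] in
/-- The row `A(u, J_k)` of the bond-`k` unfolding at `u = row b x ⊕ sfx s b (k-b)` is
`t ↦ segVal s b k x t`.  [cite: Savostyanov2014, §3 Lemma 2] -/
theorem segVal_right (s : ℕ → σ) {b k : ℕ} (hbk : b ≤ k) (x : Fin (p.χ b)) (t : Fin (p.χ k)) :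
    p.segVal F s b k x t = unfoldingKernel F (p.row b x ++ sfx s b (k - b)) (p.col k t) := by
  rw [p.segVal_eq_unfoldingKernel F s hbk le_rfl, Nat.sub_self, sfx_zero'', List.nil_append]

omit [CommRing K] in
/-- The column `A(I_k, v)` of the bond-`k` unfolding at `v = sfx s k (e-k) ⊕ col e y` is
`t ↦ segVal s k e t y`.  [cite: Savostyanov2014, §3 Lemma 2] -/
theorem segVal_left (s : ℕ → σ) {k e : ℕ} (hke : k ≤ e) (t : Fin (p.χ k)) (y : Fin (p.χ e)) :
    p.segVal F s k e t y = unfoldingKernel F (p.row k t) (sfx s k (e - k) ++ p.col e y) := by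
  rw [p.segVal_eq_unfoldingKernel F s le_rfl hke, Nat.sub_self, sfx_zero'', List.append_nil]

/-- THE CROSS OF THE BOND-`k` UNFOLDING at a genuine entry `(u, v)`, written with the row
`c = A(u, J_k)` and the column `r = A(I_k, v)`: `(crossInterp A^{k} I_k J_k)_{u v} = c P_k⁻¹ r`.
[cite: Savostyanov2014, §3 eq. (qt)] -/
theorem crossInterp_unfoldingKernel_apply (k : ℕ) (u v : List σ) :
    Literature.LinearAlgebra.Matrix.crossInterp (unfoldingKernel F) (p.row k) (p.col k) u v =
      ((fun t => unfoldingKernel F u (p.col k t)) ᵥ* (p.pivMat F k)⁻¹) ⬝ᵥ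
        fun t => unfoldingKernel F (p.row k t) v := by
  rw [Literature.LinearAlgebra.Matrix.crossInterp, ← p.pivMat_eq_submatrix_unfoldingKernel F k,
    Matrix.mul_apply]
  simp only [Matrix.mul_apply, Matrix.submatrix_apply, id_eq, dotProduct, Matrix.vecMul]

/-- THE NODE OF THE TREE IS THE CROSS OF ITS CHILDREN, entrywise: for `b < k < e`,
`(segForm s b e)_{x y} = c' P_k⁻¹ r'` with `c' = (segForm s b k)_{x ·}` and
`r' = (segForm s k e)_{· y}` the children's interpolants of the row `A(u, J_k)` and the column
`A(I_k, v)`.  [cite: Savostyanov2014, §3 Lemma 2 (the term `T_□ B^{[k]} T_◇`)] -/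
theorem segForm_apply_eq_vecMul_dotProduct (s : ℕ → σ) {b k e : ℕ} (hbk : b < k) (hke : k < e)
    (x : Fin (p.χ b)) (y : Fin (p.χ e)) :
    p.segForm F s b e x y =
      ((fun t : Fin (p.χ k) => p.segForm F s b k x t) ᵥ* (p.pivMat F k)⁻¹) ⬝ᵥ
        fun t : Fin (p.χ k) => p.segForm F s k e t y := by
  rw [p.segForm_split F s hbk e hke, ← Matrix.mul_assoc, Matrix.mul_apply, dotProduct]
  refine Finset.sum_congr rfl fun t _ => ?_
  simp only [Matrix.mul_apply, Matrix.vecMul, dotProduct]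

/-- THE ERROR DECOMPOSITION AT A NODE (Lemma 2, exact form): for `b < k < e`, with
`u = row b x ⊕ sfx s b (k-b)`, `v = sfx s k (e-k) ⊕ col e y`, `c = A(u, J_k)`, `r = A(I_k, v)`
and the children's interpolants `c'`, `r'`,
`A(u ⊕ v) - (segForm s b e)_{x y} = [A - crossInterp A^{k}]_{u v} + (c P_k⁻¹ r - c' P_k⁻¹ r')`:
the one-bond cross-interpolation error of the unfolding plus the splitting perturbation.
[cite: Savostyanov2014, §3 Lemma 2 (proof)] -/
theorem segVal_sub_segForm_eq (s : ℕ → σ) {b k e : ℕ} (hbk : b < k) (hke : k < e)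
    (x : Fin (p.χ b)) (y : Fin (p.χ e)) :
    p.segVal F s b e x y - p.segForm F s b e x y =
      (unfoldingKernel F -
          Literature.LinearAlgebra.Matrix.crossInterp (unfoldingKernel F) (p.row k) (p.col k))
        (p.row b x ++ sfx s b (k - b)) (sfx s k (e - k) ++ p.col e y) +
      (((fun t => p.segVal F s b k x t) ᵥ* (p.pivMat F k)⁻¹) ⬝ᵥ (fun t => p.segVal F s k e t y) -
        ((fun t => p.segForm F s b k x t) ᵥ* (p.pivMat F k)⁻¹) ⬝ᵥ fun t => p.segForm F s k e t y) := by
  rw [Matrix.sub_apply, p.crossInterp_unfoldingKernel_apply F k,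
    ← p.segVal_eq_unfoldingKernel F s hbk.le hke.le, ← p.segForm_apply_eq_vecMul_dotProduct F s hbk hke]
  have hc : (fun t => unfoldingKernel F (p.row b x ++ sfx s b (k - b)) (p.col k t)) =
      fun t => p.segVal F s b k x t := funext fun t => (p.segVal_right F s hbk.le x t).symm
  have hr : (fun t => unfoldingKernel F (p.row k t) (sfx s k (e - k) ++ p.col e y)) =
      fun t => p.segVal F s k e t y := funext fun t => (p.segVal_left F s hke.le t y).symm
  rw [hc, hr]
  ring

end CommRing

/-! ### Norm bounds: one node, the whole balanced tree, and the closed forms -/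

section Normed

variable {𝕜 : Type*} [NormedField 𝕜] (F : List σ → 𝕜)

/-- ONE NODE OF THE TREE (Lemma 2 with absolute errors): for `b < k < e ≤ n+1`, if the children
interpolate the row `A(u, J_k)` and the column `A(I_k, v)` within `δ₁`, `δ₂`, the pivot block
`P_k` is `γ₁`/`γ₂`-dominant in that row / column (`‖A(u, J_k) P_k⁻¹‖ ≤ γ₁`, `‖P_k⁻¹ A(I_k, v)‖ ≤ γ₂`),
`‖P_k⁻¹‖ ≤ β` entrywise and the one-bond cross of the unfolding errs by at most `η` at `(u, v)`,
then the node errs by at most `η + χ_k γ₁ δ₂ + χ_k δ₁ γ₂ + χ_k (χ_k δ₁ β) δ₂` at `(x; y)`.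
[cite: Savostyanov2014, §3 Lemma 2] -/
theorem norm_segVal_sub_segForm_le_step (s : ℕ → σ) {b k e : ℕ} (hbk : b < k) (hke : k < e)
    (x : Fin (p.χ b)) (y : Fin (p.χ e)) {γ₁ γ₂ β δ₁ δ₂ η : ℝ}
    (hC : ∀ t, ‖((fun t' => p.segVal F s b k x t') ᵥ* (p.pivMat F k)⁻¹) t‖ ≤ γ₁)
    (hR : ∀ t, ‖((p.pivMat F k)⁻¹ *ᵥ fun t' => p.segVal F s k e t' y) t‖ ≤ γ₂)
    (hβ : ∀ t t', ‖(p.pivMat F k)⁻¹ t t'‖ ≤ β)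
    (h₁ : ∀ t, ‖p.segVal F s b k x t - p.segForm F s b k x t‖ ≤ δ₁)
    (h₂ : ∀ t, ‖p.segVal F s k e t y - p.segForm F s k e t y‖ ≤ δ₂)
    (hη : ‖(unfoldingKernel F -
        Literature.LinearAlgebra.Matrix.crossInterp (unfoldingKernel F) (p.row k) (p.col k))
        (p.row b x ++ sfx s b (k - b)) (sfx s k (e - k) ++ p.col e y)‖ ≤ η) :
    ‖p.segVal F s b e x y - p.segForm F s b e x y‖ ≤
      η + ((p.χ k : ℝ) * (γ₁ * δ₂) + p.χ k * (δ₁ * γ₂) + p.χ k * (p.χ k * (δ₁ * β) * δ₂)) := by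
  rw [p.segVal_sub_segForm_eq F s hbk hke]
  refine (norm_add_le _ _).trans (add_le_add hη ?_)
  have h := norm_vecMul_dotProduct_sub_le (p.pivMat F k)⁻¹ (fun t => p.segVal F s b k x t)
    (fun t => p.segForm F s b k x t) (fun t => p.segVal F s k e t y) (fun t => p.segForm F s k e t y)
    hC hR hβ h₁ h₂
  simpa only [Fintype.card_fin] using h

/-- THE BALANCED DIMENSION TREE (heart of the proof of Theorem 1): suppose at every inner bond
`1 ≤ k ≤ n` the pivot block `P_k` is `γ`-DOMINANT in the genuine rows and columns of the bond-`k`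
unfolding `A^{k}` (`‖A(u, J_k) P_k⁻¹‖ ≤ γ`, `‖P_k⁻¹ A(I_k, v)‖ ≤ γ`; `γ = 1` for maximal volume),
`‖P_k⁻¹‖ ≤ β_k` entrywise with `χ_k β_k a ≤ κ` (`κ ≥ r_k |A| |A_k⁻¹|`, Savostyanov's `ϰ`, when
`a = |A|`), `χ_k ≤ r`, and the ONE-BOND cross interpolation of `A^{k}` on `(I_k, J_k)` errs by at
most `ε₁ a` at every genuine entry.  Then for every segment of `m ≥ 1` legs `b, …, e-1`
(`e = b + m ≤ n+1`) the segment train interpolates its subtensor within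
`treeErr γ κ r ε₁ ⌈log₂ m⌉ · a` — by strong induction on `m`, splitting at `k = b + ⌊m/2⌋`
(a balanced tree has `⌈log₂ m⌉` levels above the leaves) and applying the node estimate with the
monotonicity of `treeErr`.  [cite: Savostyanov2014, §3 Thm. 1 (proof)] -/
theorem norm_segVal_sub_segForm_le_treeErr (s : ℕ → σ) {γ κ ε₁ a : ℝ} {r : ℕ} (β : ℕ → ℝ)
    (hγ : 0 ≤ γ) (hκ₀ : 0 ≤ κ) (hε₁ : 0 ≤ ε₁) (ha : 0 ≤ a)
    (hχ : ∀ k, 1 ≤ k → k ≤ p.n → p.χ k ≤ r)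
    (hβ : ∀ k, 1 ≤ k → k ≤ p.n → ∀ t t', ‖(p.pivMat F k)⁻¹ t t'‖ ≤ β k)
    (hκ : ∀ k, 1 ≤ k → k ≤ p.n → (p.χ k : ℝ) * β k * a ≤ κ)
    (hdomC : ∀ k, 1 ≤ k → k ≤ p.n → ∀ u : List σ, u.length = k → ∀ t,
      ‖((fun t' => unfoldingKernel F u (p.col k t')) ᵥ* (p.pivMat F k)⁻¹) t‖ ≤ γ)
    (hdomR : ∀ k, 1 ≤ k → k ≤ p.n → ∀ v : List σ, v.length = p.n + 1 - k → ∀ t,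
      ‖((p.pivMat F k)⁻¹ *ᵥ fun t' => unfoldingKernel F (p.row k t') v) t‖ ≤ γ)
    (hε : ∀ k, 1 ≤ k → k ≤ p.n → ∀ u v : List σ, u.length = k → v.length = p.n + 1 - k →
      ‖(unfoldingKernel F -
          Literature.LinearAlgebra.Matrix.crossInterp (unfoldingKernel F) (p.row k) (p.col k)) u v‖
        ≤ ε₁ * a) :
    ∀ m, 1 ≤ m → ∀ b e, e = b + m → e ≤ p.n + 1 → ∀ (x : Fin (p.χ b)) (y : Fin (p.χ e)),
      ‖p.segVal F s b e x y - p.segForm F s b e x y‖ ≤ treeErr γ κ r ε₁ (Nat.clog 2 m) * a := by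
  intro m
  induction m using Nat.strong_induction_on with
  | _ m ih =>
    intro hm b e hem he x y
    rcases Nat.lt_or_ge m 2 with hm2 | hm2
    · -- a leaf: one leg, exact
      obtain rfl : m = 1 := by omega
      subst hem
      rw [p.segVal_succ_eq_segForm F s b x y, sub_self, norm_zero, Nat.clog_one_right, treeErr_zero,
        zero_mul]
    · -- an inner node: split at `k = b + m / 2`
      set m₁ := m / 2 with hm₁
      set m₂ := m - m / 2 with hm₂
      set k := b + m₁ with hk
      have hm₁1 : 1 ≤ m₁ := by omega
      have hm₂1 : 1 ≤ m₂ := by omega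
      have hm₁m : m₁ < m := by omega
      have hm₂m : m₂ < m := by omega
      have hbk : b < k := by omega
      have hke : k < e := by omega
      have hk1 : 1 ≤ k := by omega
      have hkn : k ≤ p.n := by omega
      have hclog : Nat.clog 2 m = Nat.clog 2 m₂ + 1 := by
        rw [Nat.clog_of_two_le one_lt_two hm2, hm₂]
        congr 2
        omega
      have hclog₁ : Nat.clog 2 m₁ ≤ Nat.clog 2 m₂ := Nat.clog_mono_right 2 (by omega)
      set E := treeErr γ κ r ε₁ (Nat.clog 2 m₂) with hE
      have hE₀ : 0 ≤ E := treeErr_nonneg hγ hκ₀ (Nat.cast_nonneg r) hε₁ _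
      have hmono := treeErr_mono hγ hκ₀ (Nat.cast_nonneg r) hε₁
      -- the children
      have h₁ : ∀ t, ‖p.segVal F s b k x t - p.segForm F s b k x t‖ ≤ E * a := fun t =>
        (ih m₁ hm₁m hm₁1 b k hk (by omega) x t).trans
          (mul_le_mul_of_nonneg_right (hmono hclog₁) ha)
      have h₂ : ∀ t, ‖p.segVal F s k e t y - p.segForm F s k e t y‖ ≤ E * a := fun t =>
        ih m₂ hm₂m hm₂1 k e (by omega) he t y
      -- the hypotheses at the node
      have hu : (p.row b x ++ sfx s b (k - b)).length = k := p.length_row_append_sfx s hbk.le x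
      have hv : (sfx s k (e - k) ++ p.col e y).length = p.n + 1 - k :=
        p.length_sfx_append_col s hke.le he y
      have hC : ∀ t, ‖((fun t' => p.segVal F s b k x t') ᵥ* (p.pivMat F k)⁻¹) t‖ ≤ γ := by
        intro t
        have h := hdomC k hk1 hkn _ hu t
        have hc : (fun t' => unfoldingKernel F (p.row b x ++ sfx s b (k - b)) (p.col k t')) =
            fun t' => p.segVal F s b k x t' := funext fun t' => (p.segVal_right F s hbk.le x t').symm
        rwa [hc] at h
      have hR : ∀ t, ‖((p.pivMat F k)⁻¹ *ᵥ fun t' => p.segVal F s k e t' y) t‖ ≤ γ := by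
        intro t
        have h := hdomR k hk1 hkn _ hv t
        have hr' : (fun t' => unfoldingKernel F (p.row k t') (sfx s k (e - k) ++ p.col e y)) =
            fun t' => p.segVal F s k e t' y := funext fun t' => (p.segVal_left F s hke.le t' y).symm
        rwa [hr'] at h
      have hstep := p.norm_segVal_sub_segForm_le_step F s hbk hke x y hC hR (hβ k hk1 hkn) h₁ h₂
        (hε k hk1 hkn _ _ hu hv)
      refine hstep.trans ?_
      -- bookkeeping: `ε₁ a + χ_k γ E a + χ_k E a γ + χ_k (χ_k E a β_k) E a ≤ treeErr (l+1) a`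
      rw [hclog, treeErr_succ, ← hE]
      have hχk : (p.χ k : ℝ) ≤ r := by exact_mod_cast hχ k hk1 hkn
      have hχ0 : (0 : ℝ) ≤ p.χ k := Nat.cast_nonneg _
      have hκk := hκ k hk1 hkn
      have t1 : (p.χ k : ℝ) * (γ * (E * a)) ≤ r * (γ * (E * a)) :=
        mul_le_mul_of_nonneg_right hχk (by positivity)
      have t3 : (p.χ k : ℝ) * (p.χ k * (E * a * β k) * (E * a)) ≤ κ * (r * (E * E * a)) := by
        have e3 : (p.χ k : ℝ) * (p.χ k * (E * a * β k) * (E * a)) =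
            (p.χ k * β k * a) * (p.χ k * (E * E * a)) := by ring
        rw [e3]
        calc (p.χ k : ℝ) * β k * a * (p.χ k * (E * E * a))
            ≤ κ * (p.χ k * (E * E * a)) := mul_le_mul_of_nonneg_right hκk (by positivity)
          _ ≤ κ * (r * (E * E * a)) :=
              mul_le_mul_of_nonneg_left (mul_le_mul_of_nonneg_right hχk (by positivity)) hκ₀
      have e4 : ((2 * γ + κ * E) * E * r + ε₁) * a =
          ε₁ * a + (r * (γ * (E * a)) + r * (γ * (E * a)) + κ * (r * (E * E * a))) := by ring
      rw [e4, show (E * a * γ) = γ * (E * a) by ring]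
      linarith

/-- THEOREM 1 IN RECURSIVE FORM, for any normed field and any pivots: under the bondwise
hypotheses of `norm_segVal_sub_segForm_le_treeErr` (γ-dominance, `χ_k β_k a ≤ κ`, `χ_k ≤ r`,
one-bond cross errors `≤ ε₁ a`), the TT interpolation formula `Ã = T₀ P₁⁻¹ T₁ ⋯ P_n⁻¹ T_n`
satisfies `‖A(s) - Ã(s)‖ ≤ treeErr γ κ r ε₁ ⌈log₂ d⌉ · a` at every configuration (`d = n+1` legs).
[cite: Savostyanov2014, §3 Thm. 1] -/
theorem norm_sub_tciEval_le_treeErr (s : ℕ → σ) {γ κ ε₁ a : ℝ} {r : ℕ} (β : ℕ → ℝ)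
    (hγ : 0 ≤ γ) (hκ₀ : 0 ≤ κ) (hε₁ : 0 ≤ ε₁) (ha : 0 ≤ a)
    (hχ : ∀ k, 1 ≤ k → k ≤ p.n → p.χ k ≤ r)
    (hβ : ∀ k, 1 ≤ k → k ≤ p.n → ∀ t t', ‖(p.pivMat F k)⁻¹ t t'‖ ≤ β k)
    (hκ : ∀ k, 1 ≤ k → k ≤ p.n → (p.χ k : ℝ) * β k * a ≤ κ)
    (hdomC : ∀ k, 1 ≤ k → k ≤ p.n → ∀ u : List σ, u.length = k → ∀ t,
      ‖((fun t' => unfoldingKernel F u (p.col k t')) ᵥ* (p.pivMat F k)⁻¹) t‖ ≤ γ)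
    (hdomR : ∀ k, 1 ≤ k → k ≤ p.n → ∀ v : List σ, v.length = p.n + 1 - k → ∀ t,
      ‖((p.pivMat F k)⁻¹ *ᵥ fun t' => unfoldingKernel F (p.row k t') v) t‖ ≤ γ)
    (hε : ∀ k, 1 ≤ k → k ≤ p.n → ∀ u v : List σ, u.length = k → v.length = p.n + 1 - k →
      ‖(unfoldingKernel F -
          Literature.LinearAlgebra.Matrix.crossInterp (unfoldingKernel F) (p.row k) (p.col k)) u v‖
        ≤ ε₁ * a) :
    ‖F (pfx s (p.n + 1)) - p.tciEval F s‖ ≤ treeErr γ κ r ε₁ (Nat.clog 2 (p.n + 1)) * a := by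
  rw [← p.segVal_zero_last F s, p.tciEval_eq_segForm_apply F s]
  exact p.norm_segVal_sub_segForm_le_treeErr F s β hγ hκ₀ hε₁ ha hχ hβ hκ hdomC hdomR hε
    (p.n + 1) (by omega) 0 (p.n + 1) (by omega) le_rfl _ _

/-- THEOREM 1, CLOSED FORM: under the hypotheses of `norm_sub_tciEval_le_treeErr` and the
smallness assumption `(2γr + κr + 1)^{⌈log₂ d⌉ - 1} ε₁ ≤ 1` (Savostyanov's "`E` sufficiently
small", which keeps the relative error below `1` at every level),
`‖A(s) - Ã(s)‖ ≤ (2γr + κr + 1)^{⌈log₂ d⌉ - 1} ε₁ a` — a balanced tree over `d` legs has exactly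
`⌈log₂ d⌉` levels above the leaves.  [cite: Savostyanov2014, §3 Thm. 1] -/
theorem norm_sub_tciEval_le_pow_mul (s : ℕ → σ) {γ κ ε₁ a : ℝ} {r : ℕ} (β : ℕ → ℝ)
    (hγ : 0 ≤ γ) (hκ₀ : 0 ≤ κ) (hε₁ : 0 ≤ ε₁) (ha : 0 ≤ a)
    (hχ : ∀ k, 1 ≤ k → k ≤ p.n → p.χ k ≤ r)
    (hβ : ∀ k, 1 ≤ k → k ≤ p.n → ∀ t t', ‖(p.pivMat F k)⁻¹ t t'‖ ≤ β k)
    (hκ : ∀ k, 1 ≤ k → k ≤ p.n → (p.χ k : ℝ) * β k * a ≤ κ)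
    (hdomC : ∀ k, 1 ≤ k → k ≤ p.n → ∀ u : List σ, u.length = k → ∀ t,
      ‖((fun t' => unfoldingKernel F u (p.col k t')) ᵥ* (p.pivMat F k)⁻¹) t‖ ≤ γ)
    (hdomR : ∀ k, 1 ≤ k → k ≤ p.n → ∀ v : List σ, v.length = p.n + 1 - k → ∀ t,
      ‖((p.pivMat F k)⁻¹ *ᵥ fun t' => unfoldingKernel F (p.row k t') v) t‖ ≤ γ)
    (hε : ∀ k, 1 ≤ k → k ≤ p.n → ∀ u v : List σ, u.length = k → v.length = p.n + 1 - k →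
      ‖(unfoldingKernel F -
          Literature.LinearAlgebra.Matrix.crossInterp (unfoldingKernel F) (p.row k) (p.col k)) u v‖
        ≤ ε₁ * a)
    (hsmall : (2 * γ * r + κ * r + 1) ^ (Nat.clog 2 (p.n + 1) - 1) * ε₁ ≤ 1) :
    ‖F (pfx s (p.n + 1)) - p.tciEval F s‖ ≤
      (2 * γ * r + κ * r + 1) ^ (Nat.clog 2 (p.n + 1) - 1) * ε₁ * a :=
  (p.norm_sub_tciEval_le_treeErr F s β hγ hκ₀ hε₁ ha hχ hβ hκ hdomC hdomR hε).trans
    (mul_le_mul_of_nonneg_right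
      (treeErr_le_pow_mul_top hγ hκ₀ (Nat.cast_nonneg r) hε₁ hsmall) ha)

/-- THEOREM 1 WITH THE PRINTED EXPONENT `⌈log₂ d⌉` (one factor weaker than
`norm_sub_tciEval_le_pow_mul`, as in [Savostyanov2014]: "`2^l ≤ 2d`, `l ≤ log₂ d + 1`").
[cite: Savostyanov2014, §3 Thm. 1 eq. (q1t)] -/
theorem norm_sub_tciEval_le_pow_clog_mul (s : ℕ → σ) {γ κ ε₁ a : ℝ} {r : ℕ} (β : ℕ → ℝ)
    (hγ : 0 ≤ γ) (hκ₀ : 0 ≤ κ) (hε₁ : 0 ≤ ε₁) (ha : 0 ≤ a)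
    (hχ : ∀ k, 1 ≤ k → k ≤ p.n → p.χ k ≤ r)
    (hβ : ∀ k, 1 ≤ k → k ≤ p.n → ∀ t t', ‖(p.pivMat F k)⁻¹ t t'‖ ≤ β k)
    (hκ : ∀ k, 1 ≤ k → k ≤ p.n → (p.χ k : ℝ) * β k * a ≤ κ)
    (hdomC : ∀ k, 1 ≤ k → k ≤ p.n → ∀ u : List σ, u.length = k → ∀ t,
      ‖((fun t' => unfoldingKernel F u (p.col k t')) ᵥ* (p.pivMat F k)⁻¹) t‖ ≤ γ)
    (hdomR : ∀ k, 1 ≤ k → k ≤ p.n → ∀ v : List σ, v.length = p.n + 1 - k → ∀ t,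
      ‖((p.pivMat F k)⁻¹ *ᵥ fun t' => unfoldingKernel F (p.row k t') v) t‖ ≤ γ)
    (hε : ∀ k, 1 ≤ k → k ≤ p.n → ∀ u v : List σ, u.length = k → v.length = p.n + 1 - k →
      ‖(unfoldingKernel F -
          Literature.LinearAlgebra.Matrix.crossInterp (unfoldingKernel F) (p.row k) (p.col k)) u v‖
        ≤ ε₁ * a)
    (hsmall : (2 * γ * r + κ * r + 1) ^ (Nat.clog 2 (p.n + 1) - 1) * ε₁ ≤ 1) :
    ‖F (pfx s (p.n + 1)) - p.tciEval F s‖ ≤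
      (2 * γ * r + κ * r + 1) ^ Nat.clog 2 (p.n + 1) * ε₁ * a := by
  have hG₁ : (1:ℝ) ≤ 2 * γ * r + κ * r + 1 := by
    nlinarith [mul_nonneg hκ₀ (Nat.cast_nonneg r),
      mul_nonneg (mul_nonneg (by norm_num : (0:ℝ) ≤ 2) hγ) (Nat.cast_nonneg r)]
  refine (p.norm_sub_tciEval_le_pow_mul F s β hγ hκ₀ hε₁ ha hχ hβ hκ hdomC hdomR hε hsmall).trans ?_
  exact mul_le_mul_of_nonneg_right
    (mul_le_mul_of_nonneg_right (pow_le_pow_right₀ hG₁ (Nat.sub_le _ _)) hε₁) ha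

end Normed

/-! ### The finite unfoldings and the verbatim maximal-volume statement (Theorem 1)

The bond-`k` unfolding `A^{k} = [A(i_{≤k}; i_{>k})]` over genuine multi-indices is
`TCIPivots.unfolding` of `TensorCrossExactRecovery` (rows = length-`k` vectors, columns =
length-`(n+1-k)` vectors, entries `F(u ⊕ v)`); Theorem 1 asks the pivot blocks to have maximal
volume in these matrices. -/

section Unfolding

variable {K : Type*} (F : List σ → K)

/-- The column pivots `J_k` of bond `k` as length-`(n+1-k)` vectors (column indices of the
unfolding `A^{k}`); companion of `rowVec`.  [cite: Savostyanov2014, §3 Thm. 1] -/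
def colVec (k : ℕ) (t : Fin (p.χ k)) : List.Vector σ (p.n + 1 - k) :=
  ⟨p.col k t, p.length_col k t⟩

/-- [folklore] -/
@[simp] private theorem colVec_val (k : ℕ) (t : Fin (p.χ k)) : (p.colVec k t).1 = p.col k t := rfl

/-- [folklore] -/
@[simp] private theorem rowVec_val' (k : ℕ) (t : Fin (p.χ k)) : (p.rowVec k t).1 = p.row k t := rfl

/-- The pivot block of bond `k` is the submatrix `(I_k, J_k)` of the unfolding `A^{k}`:
`A^{k}[rowVec k, colVec k] = P_k`.  [cite: Savostyanov2014, §1 (`A_k = [A(I^{≤k}, J^{>k})]`)] -/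
theorem unfolding_submatrix_rowVec_colVec [CommRing K] (k : ℕ) :
    (p.unfolding F k).submatrix (p.rowVec k) (p.colVec k) = p.pivMat F k :=
  Matrix.ext fun _ _ => rfl

end Unfolding

section MaxVolTree

variable (F : List σ → ℝ)

/-- MAXIMAL VOLUME IN THE UNFOLDING ⇒ ROW DOMINANCE at genuine rows (`γ = 1`): if `P_k` is
nonsingular and `|det P_k|` is maximal among the `χ_k × χ_k` submatrices of `A^{k}`, then
`|A(u, J_k) P_k⁻¹| ≤ 1` entrywise for every genuine row index `u` — [Savostyanov2014, (dom)] via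
`Literature.LinearAlgebra.Matrix.abs_mul_inv_submatrix_le_one_of_volume_maximal`.
[cite: Savostyanov2014, §2 eq. (dom) and §3 Lemma 2 (proof)] -/
theorem norm_vecMul_inv_pivMat_le_one_of_volume_maximal [Fintype σ] {k : ℕ}
    (hP : IsUnit (p.pivMat F k).det)
    (hmax : ∀ (r' : Fin (p.χ k) → List.Vector σ k) (c' : Fin (p.χ k) → List.Vector σ (p.n + 1 - k)),
      |((p.unfolding F k).submatrix r' c').det| ≤ |(p.pivMat F k).det|)
    (u : List σ) (hu : u.length = k) (t : Fin (p.χ k)) :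
    ‖((fun t' => unfoldingKernel F u (p.col k t')) ᵥ* (p.pivMat F k)⁻¹) t‖ ≤ 1 := by
  have hAP : ((p.unfolding F k).submatrix id (p.colVec k)).submatrix (p.rowVec k) id =
      p.pivMat F k := Matrix.ext fun _ _ => rfl
  have hP' : IsUnit (((p.unfolding F k).submatrix id (p.colVec k)).submatrix (p.rowVec k) id).det := by
    rw [hAP]; exact hP
  have hmax' : ∀ i j,
      |(((p.unfolding F k).submatrix id (p.colVec k)).submatrix
          (Function.update (p.rowVec k) j i) id).det| ≤
        |(((p.unfolding F k).submatrix id (p.colVec k)).submatrix (p.rowVec k) id).det| :=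
    fun i j => by
    rw [hAP]
    exact hmax (Function.update (p.rowVec k) j i) (p.colVec k)
  have key := Literature.LinearAlgebra.Matrix.abs_mul_inv_submatrix_le_one_of_volume_maximal
    ((p.unfolding F k).submatrix id (p.colVec k)) (p.rowVec k) hP' hmax' ⟨u, hu⟩ t
  rw [hAP] at key
  have e : ((fun t' => unfoldingKernel F u (p.col k t')) ᵥ* (p.pivMat F k)⁻¹) t =
      ((p.unfolding F k).submatrix id (p.colVec k) * (p.pivMat F k)⁻¹) ⟨u, hu⟩ t := by
    simp only [Matrix.mul_apply, Matrix.vecMul, dotProduct, Matrix.submatrix_apply, id_eq,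
      unfolding_apply, unfoldingKernel_apply, colVec_val]
  rw [Real.norm_eq_abs, e]
  exact key

/-- MAXIMAL VOLUME IN THE UNFOLDING ⇒ COLUMN DOMINANCE at genuine columns (`γ = 1`):
`|P_k⁻¹ A(I_k, v)| ≤ 1` entrywise — [Savostyanov2014, (dom)] via
`Literature.LinearAlgebra.Matrix.abs_inv_submatrix_mul_le_one_of_volume_maximal`.
[cite: Savostyanov2014, §2 eq. (dom) and §3 Lemma 2 (proof)] -/
theorem norm_inv_pivMat_mulVec_le_one_of_volume_maximal [Fintype σ] {k : ℕ}
    (hP : IsUnit (p.pivMat F k).det)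
    (hmax : ∀ (r' : Fin (p.χ k) → List.Vector σ k) (c' : Fin (p.χ k) → List.Vector σ (p.n + 1 - k)),
      |((p.unfolding F k).submatrix r' c').det| ≤ |(p.pivMat F k).det|)
    (v : List σ) (hv : v.length = p.n + 1 - k) (t : Fin (p.χ k)) :
    ‖((p.pivMat F k)⁻¹ *ᵥ fun t' => unfoldingKernel F (p.row k t') v) t‖ ≤ 1 := by
  have hAP : ((p.unfolding F k).submatrix (p.rowVec k) id).submatrix id (p.colVec k) =
      p.pivMat F k := Matrix.ext fun _ _ => rfl
  have hP' : IsUnit (((p.unfolding F k).submatrix (p.rowVec k) id).submatrix id (p.colVec k)).det := by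
    rw [hAP]; exact hP
  have hmax' : ∀ i j,
      |(((p.unfolding F k).submatrix (p.rowVec k) id).submatrix id
          (Function.update (p.colVec k) i j)).det| ≤
        |(((p.unfolding F k).submatrix (p.rowVec k) id).submatrix id (p.colVec k)).det| :=
    fun i j => by
    rw [hAP]
    exact hmax (p.rowVec k) (Function.update (p.colVec k) i j)
  have key := Literature.LinearAlgebra.Matrix.abs_inv_submatrix_mul_le_one_of_volume_maximal
    ((p.unfolding F k).submatrix (p.rowVec k) id) (p.colVec k) hP' hmax' t ⟨v, hv⟩
  rw [hAP] at key
  have e : ((p.pivMat F k)⁻¹ *ᵥ fun t' => unfoldingKernel F (p.row k t') v) t =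
      ((p.pivMat F k)⁻¹ * (p.unfolding F k).submatrix (p.rowVec k) id) t ⟨v, hv⟩ := by
    simp only [Matrix.mul_apply, Matrix.mulVec, dotProduct, Matrix.submatrix_apply, id_eq,
      unfolding_apply, unfoldingKernel_apply, rowVec_val']
  rw [Real.norm_eq_abs, e]
  exact key

/-- THE ONE-BOND ERROR AT GENUINE ENTRIES (Lemma 1 / eq. (qt), (q1)): if `P_k` is nonsingular
with maximal volume in `A^{k}` and `A^{k}` is within `E` (entrywise) of a matrix of rank `≤ χ_k`,
then `|[A^{k} - crossInterp A^{k}]_{u v}| ≤ (χ_k + 1)² E` at every genuine `(u, v)` — the matrix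
maximal-volume principle `Literature.LinearAlgebra.Matrix.abs_sub_crossInterp_le_of_volume_maximal`
read on the kernel `unfoldingKernel`.  [cite: Savostyanov2014, §3 eq. (qt), (q1) and Lemma 1] -/
theorem abs_unfoldingKernel_sub_crossInterp_le_of_volume_maximal [Fintype σ] {k : ℕ} {E : ℝ}
    (hP : IsUnit (p.pivMat F k).det)
    (hmax : ∀ (r' : Fin (p.χ k) → List.Vector σ k) (c' : Fin (p.χ k) → List.Vector σ (p.n + 1 - k)),
      |((p.unfolding F k).submatrix r' c').det| ≤ |(p.pivMat F k).det|)
    (hlow : ∃ X : Matrix (List.Vector σ k) (List.Vector σ (p.n + 1 - k)) ℝ,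
      X.rank ≤ p.χ k ∧ ∀ u v, |p.unfolding F k u v - X u v| ≤ E)
    (u v : List σ) (hu : u.length = k) (hv : v.length = p.n + 1 - k) :
    ‖(unfoldingKernel F -
        Literature.LinearAlgebra.Matrix.crossInterp (unfoldingKernel F) (p.row k) (p.col k)) u v‖ ≤
      ((p.χ k : ℝ) + 1) ^ 2 * E := by
  obtain ⟨X, hXr, hXE⟩ := hlow
  have hAP : (p.unfolding F k).submatrix (p.rowVec k) (p.colVec k) = p.pivMat F k :=
    p.unfolding_submatrix_rowVec_colVec F k
  have hP' : IsUnit ((p.unfolding F k).submatrix (p.rowVec k) (p.colVec k)).det := by rwa [hAP]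
  have hmax' : ∀ (r' : Fin (p.χ k) → List.Vector σ k)
      (c' : Fin (p.χ k) → List.Vector σ (p.n + 1 - k)),
      |((p.unfolding F k).submatrix r' c').det| ≤
        |((p.unfolding F k).submatrix (p.rowVec k) (p.colVec k)).det| := fun r' c' => by
    rw [hAP]; exact hmax r' c'
  have hXr' : X.rank ≤ Fintype.card (Fin (p.χ k)) := by rwa [Fintype.card_fin]
  have key := Literature.LinearAlgebra.Matrix.abs_sub_crossInterp_le_of_volume_maximal
    (p.unfolding F k) (p.rowVec k) (p.colVec k) hP' hmax' X hXr' hXE ⟨u, hu⟩ ⟨v, hv⟩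
  rw [Fintype.card_fin] at key
  have e : (unfoldingKernel F -
      Literature.LinearAlgebra.Matrix.crossInterp (unfoldingKernel F) (p.row k) (p.col k)) u v =
      (p.unfolding F k -
        Literature.LinearAlgebra.Matrix.crossInterp (p.unfolding F k) (p.rowVec k) (p.colVec k))
          ⟨u, hu⟩ ⟨v, hv⟩ := by
    rw [Matrix.sub_apply, Matrix.sub_apply, Literature.LinearAlgebra.Matrix.crossInterp,
      Literature.LinearAlgebra.Matrix.crossInterp, hAP, ← p.pivMat_eq_submatrix_unfoldingKernel F k]
    simp only [Matrix.mul_apply, Matrix.submatrix_apply, id_eq, unfolding_apply,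
      unfoldingKernel_apply, rowVec_val', colVec_val]
  rw [Real.norm_eq_abs, e]
  exact key

/-- SAVOSTYANOV'S THEOREM 1 (Chebyshev norm), verbatim up to the explicit smallness condition.
A tensor `A` with `d = n+1` legs, finitely many values per leg; pivot sets `(I_k, J_k)` of sizes
`χ_k ≤ r` at the inner bonds `1 ≤ k ≤ n` (NO nesting assumed) whose pivot blocks
`P_k = A(I_k, J_k)` are nonsingular and have MAXIMAL VOLUME among all `χ_k × χ_k` submatrices of
the unfolding `A^{k}`; every `A^{k}` within `E` (entrywise) of a matrix of rank `≤ χ_k` (e.g. a TT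
approximation of `A` of TT-ranks `χ_k` and accuracy `E = E_C`, the standing assumption (aa));
`χ_k ‖P_k⁻¹‖_C a ≤ κ` (with `a = |A|_C` this is `κ ≥ max_k r_k |A| |A_k⁻¹|`, Savostyanov's `ϰ`);
and `E` sufficiently small: `(2r + κr + 1)^{⌈log₂ d⌉-1} (r+1)² E ≤ a`.  Then the TT interpolation
formula (ii) satisfies, at every entry,
`|A(s) - Ã(s)| ≤ (2r + κr + 1)^{⌈log₂ d⌉-1} (r+1)² E`.
[cite: Savostyanov2014, §3 Thm. 1 eq. (q1t), Chebyshev line] -/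
theorem abs_sub_tciEval_le_of_unfoldings_volume_maximal [Fintype σ] (s : ℕ → σ) {r : ℕ}
    {E a κ : ℝ} (β : ℕ → ℝ) (hE : 0 ≤ E) (ha : 0 < a) (hκ₀ : 0 ≤ κ)
    (hP : ∀ k, 1 ≤ k → k ≤ p.n → IsUnit (p.pivMat F k).det)
    (hmax : ∀ k, 1 ≤ k → k ≤ p.n →
      ∀ (r' : Fin (p.χ k) → List.Vector σ k) (c' : Fin (p.χ k) → List.Vector σ (p.n + 1 - k)),
        |((p.unfolding F k).submatrix r' c').det| ≤ |(p.pivMat F k).det|)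
    (hlow : ∀ k, 1 ≤ k → k ≤ p.n →
      ∃ X : Matrix (List.Vector σ k) (List.Vector σ (p.n + 1 - k)) ℝ,
        X.rank ≤ p.χ k ∧ ∀ u v, |p.unfolding F k u v - X u v| ≤ E)
    (hχ : ∀ k, 1 ≤ k → k ≤ p.n → p.χ k ≤ r)
    (hβ : ∀ k, 1 ≤ k → k ≤ p.n → ∀ t t', |(p.pivMat F k)⁻¹ t t'| ≤ β k)
    (hκ : ∀ k, 1 ≤ k → k ≤ p.n → (p.χ k : ℝ) * β k * a ≤ κ)
    (hsmall : (2 * r + κ * r + 1) ^ (Nat.clog 2 (p.n + 1) - 1) * (((r : ℝ) + 1) ^ 2 * E) ≤ a) :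
    |F (pfx s (p.n + 1)) - p.tciEval F s| ≤
      (2 * r + κ * r + 1) ^ (Nat.clog 2 (p.n + 1) - 1) * (((r : ℝ) + 1) ^ 2 * E) := by
  set ε₁ : ℝ := ((r : ℝ) + 1) ^ 2 * E / a with hε₁
  have hε₁0 : 0 ≤ ε₁ := by positivity
  have hε₁a : ε₁ * a = ((r : ℝ) + 1) ^ 2 * E := by
    rw [hε₁]; field_simp
  have hsmall' : (2 * (1:ℝ) * r + κ * r + 1) ^ (Nat.clog 2 (p.n + 1) - 1) * ε₁ ≤ 1 := by
    rw [mul_one, hε₁, ← mul_div_assoc, div_le_one ha]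
    exact hsmall
  have h := p.norm_sub_tciEval_le_pow_mul F s (γ := 1) β zero_le_one hκ₀ hε₁0 ha.le hχ
    (fun k h₁ h₂ t t' => by rw [Real.norm_eq_abs]; exact hβ k h₁ h₂ t t') hκ
    (fun k h₁ h₂ u hu t => p.norm_vecMul_inv_pivMat_le_one_of_volume_maximal F (hP k h₁ h₂)
      (hmax k h₁ h₂) u hu t)
    (fun k h₁ h₂ v hv t => p.norm_inv_pivMat_mulVec_le_one_of_volume_maximal F (hP k h₁ h₂)
      (hmax k h₁ h₂) v hv t)
    (fun k h₁ h₂ u v hu hv => by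
      rw [hε₁a]
      refine (p.abs_unfoldingKernel_sub_crossInterp_le_of_volume_maximal F (hP k h₁ h₂)
        (hmax k h₁ h₂) (hlow k h₁ h₂) u v hu hv).trans ?_
      have hχr : (p.χ k : ℝ) ≤ r := by exact_mod_cast hχ k h₁ h₂
      have h1 : ((p.χ k : ℝ) + 1) ^ 2 ≤ ((r : ℝ) + 1) ^ 2 := by gcongr
      exact mul_le_mul_of_nonneg_right h1 hE)
    hsmall'
  rw [Real.norm_eq_abs, mul_one, mul_assoc, hε₁a] at h
  exact h

/-- SAVOSTYANOV'S THEOREM 1 WITH THE PRINTED EXPONENT: under the hypotheses of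
`abs_sub_tciEval_le_of_unfoldings_volume_maximal`,
`|A(s) - Ã(s)| ≤ (2r + κr + 1)^{⌈log₂ d⌉} (r+1)² E` (`d = n+1`).
[cite: Savostyanov2014, §3 Thm. 1 eq. (q1t), Chebyshev line] -/
theorem abs_sub_tciEval_le_of_unfoldings_volume_maximal' [Fintype σ] (s : ℕ → σ) {r : ℕ}
    {E a κ : ℝ} (β : ℕ → ℝ) (hE : 0 ≤ E) (ha : 0 < a) (hκ₀ : 0 ≤ κ)
    (hP : ∀ k, 1 ≤ k → k ≤ p.n → IsUnit (p.pivMat F k).det)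
    (hmax : ∀ k, 1 ≤ k → k ≤ p.n →
      ∀ (r' : Fin (p.χ k) → List.Vector σ k) (c' : Fin (p.χ k) → List.Vector σ (p.n + 1 - k)),
        |((p.unfolding F k).submatrix r' c').det| ≤ |(p.pivMat F k).det|)
    (hlow : ∀ k, 1 ≤ k → k ≤ p.n →
      ∃ X : Matrix (List.Vector σ k) (List.Vector σ (p.n + 1 - k)) ℝ,
        X.rank ≤ p.χ k ∧ ∀ u v, |p.unfolding F k u v - X u v| ≤ E)
    (hχ : ∀ k, 1 ≤ k → k ≤ p.n → p.χ k ≤ r)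
    (hβ : ∀ k, 1 ≤ k → k ≤ p.n → ∀ t t', |(p.pivMat F k)⁻¹ t t'| ≤ β k)
    (hκ : ∀ k, 1 ≤ k → k ≤ p.n → (p.χ k : ℝ) * β k * a ≤ κ)
    (hsmall : (2 * r + κ * r + 1) ^ (Nat.clog 2 (p.n + 1) - 1) * (((r : ℝ) + 1) ^ 2 * E) ≤ a) :
    |F (pfx s (p.n + 1)) - p.tciEval F s| ≤
      (2 * r + κ * r + 1) ^ Nat.clog 2 (p.n + 1) * (((r : ℝ) + 1) ^ 2 * E) := by
  have hG₁ : (1:ℝ) ≤ 2 * r + κ * r + 1 := by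
    nlinarith [mul_nonneg hκ₀ (Nat.cast_nonneg r), (Nat.cast_nonneg r : (0:ℝ) ≤ r)]
  refine (p.abs_sub_tciEval_le_of_unfoldings_volume_maximal F s β hE ha hκ₀ hP hmax hlow hχ hβ hκ
    hsmall).trans ?_
  exact mul_le_mul_of_nonneg_right (pow_le_pow_right₀ hG₁ (Nat.sub_le _ _)) (by positivity)

end MaxVolTree

end TCIPivots

end Literature.LinearAlgebra.TensorNetworks
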